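import Mathlib.RingTheory.Localization.Module
import Mathlib.Data.Nat.Factorization.Induction
import Mathlib.Data.Nat.Factorization.Basic
import Literature.NumberTheory.DiophantineApproximation.KroneckerTheorem
import Summits.KontsevichZagierPeriods.KontsevichZagierPeriods.Theorems.HurwitzMicroSectorsNormalFormPrincipleDlogMoves

/-!
# `NormalFormPrinciple` (stmt-KontsevichZagierPeriods-3869), line `SketchIdeator1` — the dlog
# layer of the leaf `stub_boxRigidity`: a vanishing `ℤ`-combination of dlog representations is a
# relation (`dlog_sum_mem_relations`), via Mathlib's factorisation API

Pure proof file (`--supports` the crux stmt-KontsevichZagierPeriods-3869; registered sub-goal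
`dlog_sum_mem_relations`). For rationals `0 < aᵢ < bᵢ`, `cᵢ` and integers `nᵢ`, the dlog
representations `Lᵢ = [(aᵢ, bᵢ), cᵢ/y]` (value `cᵢ log (bᵢ/aᵢ)`) satisfy Conjecture 1 of
Kontsevich–Zagier in kernel form: `eval (Σ nᵢ • [Lᵢ]) = 0 ⇒ Σ nᵢ • [Lᵢ] ∈ KZ.relations`.

The proof is bookkeeping in the quotient `FormalRep ⧸ relations` (Mathlib `QuotientAddGroup`) with
the carriers `Λ(q, c) = [(1, q), c/y]` supplied by `Dlog.exists_dlog` and the four moves of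
`…NormalFormPrincipleDlogMoves.lean`:

* `c ↦ Λ(q, c)` is additive (merging, rule 1b), so it is an additive homomorphism
  `ℚ →+ FormalRep ⧸ relations` (`AddMonoidHom.mk'`; `map_sum`, `map_zsmul` for free);
* `Λ(MN, c) = Λ(M, c) + Λ(N, c)` for `M, N ≥ 1` (splitting at `M`, rule 1a, then the dilation
  `y ↦ My`, rule 2), `Λ(1, c) = 0` (empty slab); hence, by `induction_on_primes` and
  `Nat.factorization`, `Λ(n, c) = Σ_p v_p(n) • Λ(p, c)`;
* `[Lᵢ] = Λ(bᵢ/aᵢ, cᵢ) = Λ(Bᵢ, cᵢ) − Λ(Aᵢ, cᵢ)` with `bᵢ/aᵢ = Bᵢ/Aᵢ` (`Rat.num`, `Rat.den`);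
* so `Σ nᵢ • [Lᵢ] ≡ Σ_p Λ(p, C_p)` with `C_p ∈ ℚ`; soundness of the calculus
  (`relations_le_ker_eval_holds`) gives `Σ_p C_p log p = 0`, and the `ℚ`-linear independence of the
  `log p` (unique factorisation: tree `Kronecker.linearIndependent_log_of_prime`, base-changed with
  `LinearIndependent.iff_fractionRing`) forces `C_p = 0`, whence `Λ(p, 0) = 0` ends the proof.

The only arithmetic input is unique factorisation; no transcendence statement is used.
Sources: M. Kontsevich, D. Zagier, *Periods* (2001), §1.1 (`log 2 = ∫₁² dx/x`), §1.2 rules (1), (2)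
and Conjecture 1. No definitions are introduced.
-/

noncomputable section

open MeasureTheory Set Finset
open Literature.NumberTheory.Transcendental Literature.NumberTheory.Transcendental.KZ

namespace Summit.KontsevichZagierPeriods.HurwitzMicroSectors.NormalFormPrinciple.PiBox

namespace DlogFactorization

open Dlog
open QuotientAddGroup (mk')

/-! ## Linear independence of the logarithms of the primes over `ℚ` -/

/-- **A vanishing rational combination `Σ_{p ∈ S} C_p log p = 0` over a finite set of primes has all
`C_p = 0`**: the `log p` are `ℤ`-linearly independent by unique factorisation
(`Kronecker.linearIndependent_log_of_prime`), hence `ℚ`-linearly independent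
(`LinearIndependent.iff_fractionRing`). [folklore] -/
theorem eq_zero_of_sum_rat_mul_log_prime_eq_zero {S : Finset ℕ} (hS : ∀ p ∈ S, p.Prime)
    (C : ℕ → ℚ) (h : ∑ p ∈ S, (C p : ℝ) * Real.log p = 0) : ∀ p ∈ S, C p = 0 := by
  classical
  have hQ : LinearIndependent ℚ (fun p : S => Real.log (p : ℕ)) :=
    (LinearIndependent.iff_fractionRing ℤ ℚ).mp
      (Literature.NumberTheory.DiophantineApproximation.Kronecker.linearIndependent_log_of_prime
        S hS)
  rw [Fintype.linearIndependent_iff] at hQ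
  intro p hp
  have h0 := hQ (fun p => C p) ?_ ⟨p, hp⟩
  · simpa using h0
  · rw [← Finset.sum_coe_sort] at h
    simpa only [Rat.smul_def] using h

/-! ## The carriers `Λ(q, c) = [(1, q), c/y]` modulo relations -/

variable {R : ℚ → ℚ → IntegralRep 1}

/-- **Merging** on a carrier: `Λ(q, c + c') = Λ(q, c) + Λ(q, c')` modulo relations (rule 1b).
[cite: KontsevichZagier2001, §1.2 rule (1)] -/
theorem carrier_add
    (hR : ∀ q c, (R q c).domain = {x | x 0 ∈ Set.Ioo ((1:ℚ):ℝ) q} ∧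
      (R q c).integrand = fun x => (c:ℝ) / x 0)
    (q c c' : ℚ) :
    mk' relations (of (R q (c + c'))) =
      mk' relations (of (R q c)) + mk' relations (of (R q c')) := by
  have h := dlog_merge_mem_relations (R q (c + c')) (R q c) (R q c') (hR q _).1 (hR q _).1
    (hR q _).1 (fun x _ => congrFun (hR q _).2 x) (fun x _ => congrFun (hR q _).2 x)
    (fun x _ => congrFun (hR q _).2 x)
  rw [← sub_eq_zero, sub_add_eq_sub_sub, ← map_sub, ← map_sub]
  exact (QuotientAddGroup.eq_zero_iff _).mpr h

/-- **Zero integrand** on a carrier: `Λ(q, 0) = 0` modulo relations (rule 1).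
[cite: KontsevichZagier2001, §1.2 rule (1)] -/
theorem carrier_zero
    (hR : ∀ q c, (R q c).domain = {x | x 0 ∈ Set.Ioo ((1:ℚ):ℝ) q} ∧
      (R q c).integrand = fun x => (c:ℝ) / x 0)
    (q : ℚ) : mk' relations (of (R q 0)) = 0 :=
  (QuotientAddGroup.eq_zero_iff _).mpr
    (dlog_zero_mem_relations (R q 0) fun x _ => congrFun (hR q 0).2 x)

/-- **Empty carrier**: `Λ(1, c) = 0` modulo relations (null domain).
[cite: KontsevichZagier2001, §1.2 rule (1)] -/
theorem carrier_one
    (hR : ∀ q c, (R q c).domain = {x | x 0 ∈ Set.Ioo ((1:ℚ):ℝ) q} ∧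
      (R q c).integrand = fun x => (c:ℝ) / x 0)
    (c : ℚ) : mk' relations (of (R 1 c)) = 0 :=
  (QuotientAddGroup.eq_zero_iff _).mpr (slab_empty_mem_relations (R 1 c) (hR 1 c).1 le_rfl)

/-- **Additivity in the coefficient** as a bundled homomorphism consequence: integer multiples,
`Λ(q, m c) = m • Λ(q, c)` modulo relations. [cite: KontsevichZagier2001, §1.2 rule (1)] -/
theorem carrier_int_mul
    (hR : ∀ q c, (R q c).domain = {x | x 0 ∈ Set.Ioo ((1:ℚ):ℝ) q} ∧
      (R q c).integrand = fun x => (c:ℝ) / x 0)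
    (q : ℚ) (m : ℤ) (c : ℚ) :
    mk' relations (of (R q ((m : ℚ) * c))) = m • mk' relations (of (R q c)) := by
  let Λ : ℚ →+ FormalRep ⧸ relations :=
    AddMonoidHom.mk' (fun c => mk' relations (of (R q c))) (carrier_add hR q)
  have h := map_zsmul Λ m c
  rw [zsmul_eq_mul] at h
  exact h

/-- **Additivity in the coefficient** over a finite sum: `Λ(q, Σ fᵢ) = Σ Λ(q, fᵢ)` modulo
relations. [cite: KontsevichZagier2001, §1.2 rule (1)] -/
theorem carrier_finset_sum
    (hR : ∀ q c, (R q c).domain = {x | x 0 ∈ Set.Ioo ((1:ℚ):ℝ) q} ∧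
      (R q c).integrand = fun x => (c:ℝ) / x 0)
    (q : ℚ) {ι : Type*} (s : Finset ι) (f : ι → ℚ) :
    mk' relations (of (R q (∑ i ∈ s, f i))) = ∑ i ∈ s, mk' relations (of (R q (f i))) := by
  let Λ : ℚ →+ FormalRep ⧸ relations :=
    AddMonoidHom.mk' (fun c => mk' relations (of (R q c))) (carrier_add hR q)
  exact map_sum Λ f s

/-- **Multiplicativity of the carriers**: for rationals `M, N ≥ 1`,
`Λ(MN, c) = Λ(M, c) + Λ(N, c)` modulo relations — split `(1, MN)` at `M` (rule 1a) and rescale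
`(M, MN)` to `(1, N)` by the dilation `y ↦ M y` (rule 2).
[cite: KontsevichZagier2001, §1.2 rules (1), (2)] -/
theorem carrier_mul
    (hR : ∀ q c, (R q c).domain = {x | x 0 ∈ Set.Ioo ((1:ℚ):ℝ) q} ∧
      (R q c).integrand = fun x => (c:ℝ) / x 0)
    {M N : ℚ} (hM : 1 ≤ M) (hN : 1 ≤ N) (c : ℚ) :
    mk' relations (of (R (M * N) c)) = mk' relations (of (R M c)) + mk' relations (of (R N c)) := by
  have hM0 : 0 < M := one_pos.trans_le hM
  obtain ⟨T, hTd, hTi⟩ := exists_dlog (M * 1) (M * N) c (by rw [mul_one]; exact hM0)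
  -- splitting `(1, MN)` at `M`
  have hsplit : of (R (M * N) c) - of (R M c) - of T ∈ relations := by
    refine split_mem_relations (R (M * N) c) (R M c) T (hR _ _).1 (hR _ _).1 ?_ ?_ ?_ ?_ ?_
    · rw [hTd, mul_one]
    · exact_mod_cast hM
    · exact_mod_cast le_mul_of_one_le_right hM0.le hN
    · intro x _
      rw [(hR M c).2, (hR (M * N) c).2]
    · intro x _
      rw [hTi, (hR (M * N) c).2]
  -- the dilation `y ↦ M y` carries `(1, N)` onto `(M, MN)`
  have hscale : of (R N c) - of T ∈ relations :=
    dlog_scale_mem_relations (R N c) T (hR N c).1 hTd (fun x _ => congrFun (hR N c).2 x)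
      (fun x _ => congrFun hTi x) one_pos hM0
  have h : of (R (M * N) c) - of (R M c) - of (R N c) =
      (of (R (M * N) c) - of (R M c) - of T) - (of (R N c) - of T) := by abel
  rw [← sub_eq_zero, sub_add_eq_sub_sub, ← map_sub, ← map_sub]
  refine (QuotientAddGroup.eq_zero_iff _).mpr ?_
  rw [h]
  exact relations.sub_mem hsplit hscale

/-- **The factorisation lattice**: for a positive natural `n` whose prime factors lie in `S`,
`Λ(n, c) = Σ_{p ∈ S} v_p(n) • Λ(p, c)` modulo relations (`induction_on_primes`,
`Nat.factorization_mul`). [cite: KontsevichZagier2001, §1.2] -/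
theorem carrier_natCast
    (hR : ∀ q c, (R q c).domain = {x | x 0 ∈ Set.Ioo ((1:ℚ):ℝ) q} ∧
      (R q c).integrand = fun x => (c:ℝ) / x 0)
    (S : Finset ℕ) (c : ℚ) :
    ∀ n : ℕ, n ≠ 0 → (∀ p : ℕ, p.Prime → p ∣ n → p ∈ S) →
      mk' relations (of (R n c)) =
        ∑ p ∈ S, ((n.factorization p : ℕ) : ℤ) • mk' relations (of (R p c)) := by
  classical
  intro n
  induction n using induction_on_primes with
  | zero => intro h; exact absurd rfl h
  | one =>
    intro _ _
    rw [Nat.cast_one, carrier_one hR c, Nat.factorization_one]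
    simp
  | prime_mul p a hp ih =>
    intro hpa hS
    have ha : a ≠ 0 := fun h => hpa (by rw [h, mul_zero])
    have hpS : p ∈ S := hS p hp (dvd_mul_right p a)
    have hS' : ∀ r : ℕ, r.Prime → r ∣ a → r ∈ S := fun r hr hra => hS r hr (hra.mul_left p)
    rw [Nat.cast_mul, carrier_mul hR (by exact_mod_cast hp.one_lt.le)
      (by exact_mod_cast Nat.one_le_iff_ne_zero.mpr ha), ih ha hS',
      Nat.factorization_mul hp.ne_zero ha, hp.factorization]
    simp only [Finsupp.coe_add, Pi.add_apply, Nat.cast_add, add_smul, Finset.sum_add_distrib]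
    congr 1
    rw [Finset.sum_eq_single_of_mem p hpS fun r _ hrp => by
      rw [Finsupp.single_eq_of_ne hrp, Nat.cast_zero, zero_smul]]
    rw [Finsupp.single_eq_same, Nat.cast_one, one_smul]

/-! ## The theorem -/

/-- **Conjecture 1 in kernel form for the dlog family over `ℚ`** (registered sub-goal
`dlog_sum_mem_relations` of crux stmt-KontsevichZagierPeriods-3869, line `SketchIdeator1`, leaf
`stub_boxRigidity`): for `Lᵢ = [(aᵢ, bᵢ), cᵢ/y]` with rationals `0 < aᵢ < bᵢ`, `cᵢ` and integers
`nᵢ`, if `eval (Σ nᵢ • [Lᵢ]) = Σ nᵢ cᵢ log (bᵢ/aᵢ) = 0` then `Σ nᵢ • [Lᵢ] ∈ KZ.relations`.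
Unique factorisation is the only arithmetic input.
[cite: KontsevichZagier2001, §1.2 Conjecture 1] -/
theorem dlog_sum_mem_relations {k : ℕ} (n : Fin k → ℤ) (a b c : Fin k → ℚ)
    (L : Fin k → IntegralRep 1) (ha : ∀ i, 0 < a i) (hab : ∀ i, a i < b i)
    (hd : ∀ i, (L i).domain = {x | x 0 ∈ Set.Ioo (a i : ℝ) (b i)})
    (hi : ∀ i, EqOn (L i).integrand (fun x => (c i : ℝ) / x 0) (L i).domain)
    (hv : eval (∑ i, n i • of (L i)) = 0) : ∑ i, n i • of (L i) ∈ relations := by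
  classical
  -- the carriers `Λ(q, c) = [(1, q), c/y]`
  obtain ⟨R, hR⟩ : ∃ R : ℚ → ℚ → IntegralRep 1, ∀ q c,
      (R q c).domain = {x | x 0 ∈ Set.Ioo ((1:ℚ):ℝ) q} ∧ (R q c).integrand = fun x => (c:ℝ) / x 0 :=
    ⟨fun q c => (exists_dlog 1 q c one_pos).choose,
      fun q c => (exists_dlog 1 q c one_pos).choose_spec⟩
  -- numerators and denominators of the ratios `bᵢ/aᵢ > 1`
  have hq1 : ∀ i, 1 < b i / a i := fun i => (one_lt_div (ha i)).mpr (hab i)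
  have hq0 : ∀ i, 0 < b i / a i := fun i => one_pos.trans (hq1 i)
  obtain ⟨A, B, hA0, hB0, hBq⟩ : ∃ A B : Fin k → ℕ, (∀ i, A i ≠ 0) ∧ (∀ i, B i ≠ 0) ∧
      ∀ i, ((B i : ℕ) : ℚ) = (A i : ℚ) * (b i / a i) := by
    refine ⟨fun i => (b i / a i).den, fun i => (b i / a i).num.toNat, fun i => (b i / a i).den_nz,
      fun i => ?_, fun i => ?_⟩
    · have : 0 < (b i / a i).num := Rat.num_pos.mpr (hq0 i)
      show (b i / a i).num.toNat ≠ 0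
      omega
    · show (((b i / a i).num.toNat : ℕ) : ℚ) = ((b i / a i).den : ℚ) * (b i / a i)
      rw [Rat.den_mul_eq_num, ← Int.cast_natCast, Int.toNat_of_nonneg (Rat.num_pos.mpr (hq0 i)).le]
  -- a finite set of primes containing every prime factor of the `Aᵢ`, `Bᵢ`
  obtain ⟨S, hSprime, hSA, hSB⟩ : ∃ S : Finset ℕ, (∀ p ∈ S, p.Prime) ∧
      (∀ i p, p.Prime → p ∣ A i → p ∈ S) ∧ (∀ i p, p.Prime → p ∣ B i → p ∈ S) := by
    refine ⟨Finset.univ.biUnion fun i => (A i).primeFactors ∪ (B i).primeFactors, ?_, ?_, ?_⟩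
    · intro p hp
      simp only [Finset.mem_biUnion, Finset.mem_univ, true_and, Finset.mem_union] at hp
      obtain ⟨i, hp | hp⟩ := hp <;> exact Nat.prime_of_mem_primeFactors hp
    · exact fun i p hp hpd => Finset.mem_biUnion.mpr
        ⟨i, Finset.mem_univ _, Finset.mem_union_left _ (Nat.mem_primeFactors.mpr ⟨hp, hpd, hA0 i⟩)⟩
    · exact fun i p hp hpd => Finset.mem_biUnion.mpr
        ⟨i, Finset.mem_univ _, Finset.mem_union_right _ (Nat.mem_primeFactors.mpr ⟨hp, hpd, hB0 i⟩)⟩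
  -- each `[Lᵢ]` on the lattice of the prime carriers
  have hLi : ∀ i, mk' relations (of (L i)) = ∑ p ∈ S,
      ((((B i).factorization p : ℕ) : ℤ) - (((A i).factorization p : ℕ) : ℤ)) •
        mk' relations (of (R p (c i))) := by
    intro i
    -- the dilation `y ↦ y / aᵢ`
    have h1 : mk' relations (of (L i)) = mk' relations (of (R (b i / a i) (c i))) := by
      have hd' : (R (b i / a i) (c i)).domain =
          {x | x 0 ∈ Set.Ioo (((a i)⁻¹ * a i : ℚ) : ℝ) (((a i)⁻¹ * b i : ℚ) : ℝ)} := by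
        rw [(hR _ _).1, inv_mul_cancel₀ (ha i).ne', inv_mul_eq_div]
      have := dlog_scale_mem_relations (L i) (R (b i / a i) (c i)) (hd i) hd' (hi i)
        (fun x _ => congrFun (hR _ _).2 x) (ha i) (inv_pos.mpr (ha i))
      rw [← sub_eq_zero, ← map_sub]
      exact (QuotientAddGroup.eq_zero_iff _).mpr this
    -- `bᵢ/aᵢ = Bᵢ/Aᵢ`
    have h2 : mk' relations (of (R (b i / a i) (c i))) =
        mk' relations (of (R (B i) (c i))) - mk' relations (of (R (A i) (c i))) := by
      rw [hBq i, carrier_mul hR (by exact_mod_cast Nat.one_le_iff_ne_zero.mpr (hA0 i)) (hq1 i).le,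
        add_sub_cancel_left]
    rw [h1, h2, carrier_natCast hR S (c i) (B i) (hB0 i) (hSB i),
      carrier_natCast hR S (c i) (A i) (hA0 i) (hSA i), ← Finset.sum_sub_distrib]
    exact Finset.sum_congr rfl fun p _ => (sub_smul _ _ _).symm
  obtain ⟨e, he⟩ : ∃ e : Fin k → ℕ → ℤ,
      ∀ i, mk' relations (of (L i)) = ∑ p ∈ S, e i p • mk' relations (of (R p (c i))) :=
    ⟨_, hLi⟩
  -- collect the coefficients prime by prime
  have hx : mk' relations (∑ i, n i • of (L i)) =
      ∑ p ∈ S, mk' relations (of (R p (∑ i, ((n i * e i p : ℤ) : ℚ) * c i))) := by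
    rw [map_sum]
    simp_rw [map_zsmul, he, Finset.smul_sum, smul_smul]
    rw [Finset.sum_comm]
    refine Finset.sum_congr rfl fun p _ => ?_
    rw [carrier_finset_sum hR]
    refine Finset.sum_congr rfl fun i _ => ?_
    rw [carrier_int_mul hR]
  obtain ⟨C, hxC⟩ : ∃ C : ℕ → ℚ,
      mk' relations (∑ i, n i • of (L i)) = ∑ p ∈ S, mk' relations (of (R p (C p))) :=
    ⟨_, hx⟩
  -- soundness: `Σ_p C_p log p = eval (Σ nᵢ • [Lᵢ]) = 0`
  have hmem : (∑ i, n i • of (L i)) - ∑ p ∈ S, of (R p (C p)) ∈ relations := by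
    have : mk' relations ((∑ i, n i • of (L i)) - ∑ p ∈ S, of (R p (C p))) = 0 := by
      rw [map_sub, hxC, map_sum, sub_self]
    exact (QuotientAddGroup.eq_zero_iff _).mp this
  have heval : ∑ p ∈ S, (C p : ℝ) * Real.log p = 0 := by
    have hker := (relations_le_ker_eval_holds : relations ≤ eval.ker) hmem
    rw [AddMonoidHom.mem_ker, map_sub, hv, zero_sub, neg_eq_zero, map_sum] at hker
    rw [← hker]
    refine Finset.sum_congr rfl fun p hp => ?_
    rw [eval_of, value_dlog (R p (C p)) (hR _ _).1 (fun x _ => congrFun (hR _ _).2 x) one_pos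
      (by exact_mod_cast (hSprime p hp).one_lt.le)]
    simp
  -- unique factorisation: every `C_p` vanishes, and so does every `Λ(p, C_p)`
  have hC0 : ∀ p ∈ S, C p = 0 := eq_zero_of_sum_rat_mul_log_prime_eq_zero hSprime C heval
  have hfin : mk' relations (∑ i, n i • of (L i)) = 0 := by
    rw [hxC]
    exact Finset.sum_eq_zero fun p hp => by rw [hC0 p hp]; exact carrier_zero hR p
  exact (QuotientAddGroup.eq_zero_iff _).mp hfin

end DlogFactorization

end Summit.KontsevichZagierPeriods.HurwitzMicroSectors.NormalFormPrinciple.PiBox
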